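import Mathlib
import HarnessLib
import Literature.Computability.AlgebraicComplexity.AsymptoticSpectrum
import Literature.Computability.AlgebraicComplexity.BorderRankCW

/-!
# OutsiderSandwich — the TORIC CEILING of `cw₂ ⊠ cw₂`: no combinatorial degeneration reaches `⟨8⟩`
(decomp-mm lens 4 «minimal-counterexample / extremal reduction», gen 43, kernel K43-1;
THESES-FREE, `ω`-free, no `Prop`-valued definitions; helper toward `LaserTangency`, stmt-32268)

WHAT.  `LaserTangency` at `N = 2` lives on the host `P = cw₂^{⊠2} = kroneckerPow (cwTensor ℂ 2) 2`.
The lineage settled `Q(P) = 6`, `⟨7⟩ ⊴ P` (`OutsiderSandwichBorderSubrankSeven`) and `Q̲(P) ≤ 8`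
(`OutsiderSandwichBorderSubrankCeiling`), leaving `⟨8⟩ ⊴ P` open.  Every degeneration in that
lineage — and every degeneration the laser method uses on Coppersmith–Winograd powers — is TORIC: a
COMBINATORIAL DEGENERATION (Strassen 1987; Bürgisser–Clausen–Shokrollahi (15.29)): weights `a, b, c`
on the three index sets of a support frame `Φ` with `a(u)+b(v)+c(w) = 0` on the kept set `Ψ` and
`≥ 1` on `Φ ∖ Ψ` (soundness in the tree: `OutsiderSandwichBorderSubrankTwenty.isApproxRestriction_
of_monomial`).  This file decides the toric question NEGATIVELY and sharply, in both bases of `P`: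
* `cwFrame_no_diagonal_comb_degeneration_eight`: in the Coppersmith–Winograd basis (`cwFrame` =
  support of `kroneckerPow (cwTensor K 2) 2`, bridge `kroneckerPow_cwTensor_two_apply`) NO
  diagonal `Ψ` (distinct triples differ in every leg) with `#Ψ ≥ 8` is a combinatorial
  degeneration, for weights in ANY linearly ordered commutative ring;
* `tightFrame_no_diagonal_comb_degeneration_eight`: the same in the diagonalised basis `D ⊠ D`,
  `D = x₀x₁x₂ ≅ cw₂` over `ℂ` (`tightFrame`, bridge `kronecker_diag_apply`);
* `cwFrame_toric_value`: the ceiling `7` IS attained torically in the cw basis (explicit `psiSeven`,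
  weights in `[-3, 5]`), so the toric border subrank of the cw frame is exactly `7`.
So a proof of `⟨8⟩ ⊴ cw₂^{⊠2}` (the last open value, `Q̲(P) ∈ {7, 8}`) needs a degeneration that is
not monomial in either basis — outside the laser method's certificate class.  (Extremal-lens
reading: the whole obstruction is the ONE missing triple of a size-8 diagonal.)

PROOF (uniform Farkas certificates; the finite facts by kernel `decide` on the 36-triple frames).
A diagonal is leg-injective, so `#Ψ ≤ 9`.  `#Ψ = 9`: both frames are 4-regular on every leg, so
`Σ_{t ∈ Φ} (a+b+c)(t) = 4·Σ_{t ∈ Ψ} (a+b+c)(t) = 0`, contradicting `≥ #(Φ ∖ Ψ) = 27`.  `#Ψ = 8`: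
each leg misses one point `u*, v*, w*`.  STAR PINNING: counting over `t ∈ Ψ` how many legs carry
the value `α` in a fixed coordinate gives `9 − [u*=α] − [v*=α] − [w*=α]`; a tight-frame triple
carries every value exactly once, a cw-frame triple carries `0` once and `1, 2` an even number of
times — either way `s = (u*, v*, w*)` is itself a tight-frame triple (a "star").  CERTIFICATE: the
16 frame triples `H(s)` having EXACTLY ONE of their two coordinates deranged from `s` (differing
from `s` on all three legs) avoid the star points and cover every other point of every leg exactly
twice (all 36 stars, both frames); hence `Σ_{H(s)} (a+b+c) = 2·Σ_Ψ (a+b+c) = 0 < 16 − 8 ≤ Σ_{H(s)}`.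
(Rule found as the vertex `(½,0,½,0,0)` of the stabiliser-orbit LP of dual covers.)

DATA (exact rational LP, pure Python, in-seat; sources `g43/`).  Feasible diagonals by size: cw
frame `5568/7316` (6), `672/1968` (7), `0/168` (8); tight frame `3576/9012` (6), `0/2952` (7),
`0/360` (8); mixed `cw ⊠ D` `0/216` (8).  Toric value: `7` (cw frame), `6` (tight frame; its size-7
exclusion is by enumeration only, not formalised here).

HONEST SCOPE.  Negative for the toric certificate class in the two named bases only;
`AlgDegeneratesTo (kroneckerPow (cwTensor ℂ 2) 2) (unitTensor ℂ 8)` itself stays OPEN (`15 ≤ R̲(P)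
≤ 16`, Conner–Gesmundo–Landsberg–Ventura arXiv:1909.04785 p. 5, decides nothing here).  Kernel
`decide` needs `maxRecDepth 100000`; no compiled evaluation, no new axioms.
-/

set_option linter.dupNamespace false

namespace Summit.MatrixMultiplication.MatrixMultiplication.Theorems.OutsiderSandwichToricCeiling

open Finset
open Literature.Computability.AlgebraicComplexity

/-! ## §1 Frames, diagonals, certificates -/

/-- Points of one leg of `cw₂ ⊠ cw₂`: pairs of `cw₂`-indices. [new] -/
abbrev Pt : Type := Fin 3 × Fin 3

/-- Index triples `(u, v, w)` of `cw₂ ⊠ cw₂`; legs `t.1`, `t.2.1`, `t.2.2`. [new] -/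
abbrev Tr : Type := Pt × Pt × Pt

/-- Support pattern of one copy of `cw₂` (the condition of `cwTensor_apply`). [new] -/
def cwSlot (i j k : Fin 3) : Bool :=
  decide ((i = 0 ∧ j = k ∧ j ≠ 0) ∨ (j = 0 ∧ i = k ∧ i ≠ 0) ∨ (k = 0 ∧ i = j ∧ i ≠ 0))

/-- Support pattern of the diagonalised copy `D = x₀x₁x₂`: `i, j, k` pairwise distinct. [new] -/
def dSlot (i j k : Fin 3) : Bool := decide (i ≠ j ∧ j ≠ k ∧ i ≠ k)

/-- The cw FRAME: support of `cw₂ ⊠ cw₂` in the Coppersmith–Winograd basis (36 triples). [new] -/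
def cwFrame : Finset Tr :=
  univ.filter fun t => cwSlot t.1.1 t.2.1.1 t.2.2.1 = true ∧ cwSlot t.1.2 t.2.1.2 t.2.2.2 = true

/-- The TIGHT frame: support of `D ⊠ D` (36 triples); also the set of "stars". [new] -/
def tightFrame : Finset Tr :=
  univ.filter fun t => dSlot t.1.1 t.2.1.1 t.2.2.1 = true ∧ dSlot t.1.2 t.2.1.2 t.2.2.2 = true

/-- DIAGONAL (BCS (15.29)): distinct triples of `Ψ` differ in every leg. [new] -/
def isDiagonal (Ψ : Finset Tr) : Bool :=
  decide (∀ t ∈ Ψ, ∀ t' ∈ Ψ, (t.1 = t'.1 ∨ t.2.1 = t'.2.1 ∨ t.2.2 = t'.2.2) → t = t')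

/-! A COMBINATORIAL DEGENERATION `Ψ ⊴ Φ` (BCS (15.29)) is spelled out below as three hypotheses on
weights `a b c : Pt → R`: `hsub : Ψ ⊆ Φ`, `hzero : ∀ t ∈ Ψ, a t.1 + b t.2.1 + c t.2.2 = 0`,
`hone : ∀ t ∈ Φ, t ∉ Ψ → 1 ≤ a t.1 + b t.2.1 + c t.2.2`. -/

/-- Coordinate 1 of `t` is deranged from the star `s` (differs on all three legs). [new] -/
def der₁ (s t : Tr) : Bool := decide (t.1.1 ≠ s.1.1 ∧ t.2.1.1 ≠ s.2.1.1 ∧ t.2.2.1 ≠ s.2.2.1)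

/-- Coordinate 2 of `t` is deranged from the star `s`. [new] -/
def der₂ (s t : Tr) : Bool := decide (t.1.2 ≠ s.1.2 ∧ t.2.1.2 ≠ s.2.1.2 ∧ t.2.2.2 ≠ s.2.2.2)

/-- The Farkas certificate `H_Φ(s)`: frame triples with EXACTLY ONE deranged coordinate. [new] -/
def cert (Φ : Finset Tr) (s : Tr) : Finset Tr := Φ.filter fun t => der₁ s t ≠ der₂ s t

/-- How many legs of `t` carry the value `α` in coordinate 1. [new] -/
def cnt₁ (α : Fin 3) (t : Tr) : ℕ :=
  (if t.1.1 = α then 1 else 0) + (if t.2.1.1 = α then 1 else 0) + (if t.2.2.1 = α then 1 else 0)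
/-- How many legs of `t` carry the value `α` in coordinate 2. [new] -/
def cnt₂ (α : Fin 3) (t : Tr) : ℕ :=
  (if t.1.2 = α then 1 else 0) + (if t.2.1.2 = α then 1 else 0) + (if t.2.2.2 = α then 1 else 0)

/-! ## §2 Finite facts (kernel `decide`) -/

set_option maxRecDepth 100000

/-- Both frames have 36 triples and are 4-regular on every leg. [new] -/
theorem frames_regular : (36 = #cwFrame ∧ 36 = #tightFrame) ∧ ∀ p : Pt,
    (#{t ∈ cwFrame | t.1 = p} = 4 ∧ #{t ∈ cwFrame | t.2.1 = p} = 4 ∧ #{t ∈ cwFrame | t.2.2 = p} = 4) ∧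
    (#{t ∈ tightFrame | t.1 = p} = 4 ∧ #{t ∈ tightFrame | t.2.1 = p} = 4 ∧
      #{t ∈ tightFrame | t.2.2 = p} = 4) := by
  decide +kernel

/-- Tight frame: every value occurs on exactly one leg, in each coordinate. [new] -/
theorem cnt_tight : ∀ t ∈ tightFrame, ∀ α : Fin 3, cnt₁ α t = 1 ∧ cnt₂ α t = 1 := by decide +kernel

/-- cw frame: the value `0` occurs on exactly one leg, the values `1, 2` on an even number. [new] -/
theorem cnt_cw : ∀ t ∈ cwFrame, (cnt₁ 0 t = 1 ∧ cnt₂ 0 t = 1) ∧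
    ∀ α : Fin 3, α ≠ 0 → Even (cnt₁ α t) ∧ Even (cnt₂ α t) := by decide +kernel

/-- Erasing a point lowers one coordinate-fibre count of `Pt` from `3`. [new] -/
theorem card_erase_fibre : ∀ x : Pt, ∀ α : Fin 3,
    #{p ∈ univ.erase x | p.1 = α} + (if x.1 = α then 1 else 0) = 3 ∧
    #{p ∈ univ.erase x | p.2 = α} + (if x.2 = α then 1 else 0) = 3 := by decide +kernel

/-- Star pinning: values hitting `0` once and `1`, `2` an odd number of times are a permutation. [new] -/
theorem dslot_of_counts : ∀ x y z : Fin 3,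
    (if x = (0 : Fin 3) then 1 else 0) + (if y = (0 : Fin 3) then 1 else 0) +
        (if z = (0 : Fin 3) then 1 else 0) = 1 →
    Odd ((if x = (1 : Fin 3) then 1 else 0) + (if y = (1 : Fin 3) then 1 else 0) +
        (if z = (1 : Fin 3) then 1 else 0)) →
    Odd ((if x = (2 : Fin 3) then 1 else 0) + (if y = (2 : Fin 3) then 1 else 0) +
        (if z = (2 : Fin 3) then 1 else 0)) → dSlot x y z = true := by
  decide

/-- For every star and both frames, `H_Φ(s)` has 16 triples, avoids the star points and covers
every other point of every leg exactly twice. [new] -/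
theorem cert_fibres : ∀ s ∈ tightFrame, (#(cert cwFrame s) = 16 ∧ #(cert tightFrame s) = 16) ∧
    ∀ p : Pt, (#{t ∈ cert cwFrame s | t.1 = p} = (if p = s.1 then 0 else 2) ∧
      #{t ∈ cert cwFrame s | t.2.1 = p} = (if p = s.2.1 then 0 else 2) ∧
      #{t ∈ cert cwFrame s | t.2.2 = p} = (if p = s.2.2 then 0 else 2)) ∧
    (#{t ∈ cert tightFrame s | t.1 = p} = (if p = s.1 then 0 else 2) ∧
      #{t ∈ cert tightFrame s | t.2.1 = p} = (if p = s.2.1 then 0 else 2) ∧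
      #{t ∈ cert tightFrame s | t.2.2 = p} = (if p = s.2.2 then 0 else 2)) := by
  decide +kernel

/-! ## §3 The Farkas argument -/

section Generic

variable {R : Type*} [CommRing R]

/-- A diagonal is injective on each leg. [folklore] -/
theorem injOn_of_isDiagonal {Ψ : Finset Tr} (hd : isDiagonal Ψ = true) :
    Set.InjOn (fun t : Tr => t.1) Ψ ∧ Set.InjOn (fun t : Tr => t.2.1) Ψ ∧
      Set.InjOn (fun t : Tr => t.2.2) Ψ := by
  have h := of_decide_eq_true hd
  exact ⟨fun t ht t' ht' e => h t ht t' ht' (Or.inl e),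
    fun t ht t' ht' e => h t ht t' ht' (Or.inr (Or.inl e)),
    fun t ht t' ht' e => h t ht t' ht' (Or.inr (Or.inr e))⟩

/-- A diagonal has at most 9 triples. [folklore] -/
theorem card_le_nine {Ψ : Finset Tr} (hdiag : isDiagonal Ψ = true) : #Ψ ≤ 9 := by
  rw [← Finset.card_image_of_injOn (injOn_of_isDiagonal hdiag).1]
  exact (Finset.card_le_univ _).trans (by simp [Fintype.card_prod, Fintype.card_fin])

/-- An 8-point subset of `Pt` is `univ.erase x`. [folklore] -/
theorem exists_eq_erase {I : Finset Pt} (hI : #I = 8) : ∃ x : Pt, I = univ.erase x := by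
  have h1 : #(univ \ I) = 1 := by
    rw [Finset.card_univ_sdiff, hI]; simp [Fintype.card_prod, Fintype.card_fin]
  obtain ⟨x, hx⟩ := Finset.card_eq_one.mp h1
  exact ⟨x, by rw [← Finset.sdiff_singleton_eq_erase, ← hx,
    Finset.sdiff_sdiff_eq_self (Finset.subset_univ I)]⟩

/-- DOUBLE COUNTING along a leg `g`: if the `g`-fibres of `H` have size `m` over the `g`-image of the
leg-injective `Ψ` and `0` elsewhere, then `Σ_{t ∈ H} f (g t) = m · Σ_{t ∈ Ψ} f (g t)`. [folklore] -/
theorem sum_leg_eq_mul (H Ψ : Finset Tr) (g : Tr → Pt) (f : Pt → R) (m : ℕ) (hg : Set.InjOn g Ψ)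
    (hH : ∀ p, #{t ∈ H | g t = p} = if p ∈ Ψ.image g then m else 0) :
    ∑ t ∈ H, f (g t) = m * ∑ t ∈ Ψ, f (g t) := by
  rw [← Finset.sum_fiberwise' H g f, ← Finset.sum_image hg, Finset.mul_sum,
    ← Finset.sum_filter_add_sum_filter_not univ (fun p => p ∈ Ψ.image g)]
  simp only [Finset.sum_const, nsmul_eq_mul, Finset.filter_mem_eq_inter, Finset.univ_inter]
  rw [Finset.sum_eq_zero (s := univ.filter fun p => p ∉ Ψ.image g) fun p hp => by
    rw [hH p, if_neg (Finset.mem_filter.mp hp).2]; simp, add_zero]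
  exact Finset.sum_congr rfl fun p hp => by rw [hH p, if_pos hp]

/-- Counting a coordinate value over a leg image. [folklore] -/
theorem sum_ite_eq_card_image {Ψ : Finset Tr} {g : Tr → Pt} (hg : Set.InjOn g Ψ)
    (P : Pt → Prop) [DecidablePred P] :
    ∑ t ∈ Ψ, (if P (g t) then 1 else 0) = #{p ∈ Ψ.image g | P p} := by
  rw [Finset.card_filter, Finset.sum_image hg]

/-- THE FARKAS STEP.  If `H ⊆ Φ` has more triples than the diagonal `Ψ` and, on every leg, covers
the points used by `Ψ` exactly `m` times and the others not at all, then no weights make `Ψ` a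
combinatorial degeneration of `Φ`: `Σ_H (a+b+c) = m·Σ_Ψ (a+b+c) = 0 < #(H ∖ Ψ) ≤ Σ_H`. [new] -/
theorem farkas [LinearOrder R] [IsStrictOrderedRing R] {Φ Ψ H : Finset Tr} {a b c : Pt → R}
    (m : ℕ) (hzero : ∀ t ∈ Ψ, a t.1 + b t.2.1 + c t.2.2 = 0)
    (hone : ∀ t ∈ Φ, t ∉ Ψ → 1 ≤ a t.1 + b t.2.1 + c t.2.2)
    (hdiag : isDiagonal Ψ = true) (hHΦ : H ⊆ Φ) (hcard : #Ψ < #H)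
    (h₁ : ∀ p, #{t ∈ H | t.1 = p} = if p ∈ Ψ.image (fun t : Tr => t.1) then m else 0)
    (h₂ : ∀ p, #{t ∈ H | t.2.1 = p} = if p ∈ Ψ.image (fun t : Tr => t.2.1) then m else 0)
    (h₃ : ∀ p, #{t ∈ H | t.2.2 = p} = if p ∈ Ψ.image (fun t : Tr => t.2.2) then m else 0) :
    False := by
  obtain ⟨j₁, j₂, j₃⟩ := injOn_of_isDiagonal hdiag
  have hH : ∑ t ∈ H, (a t.1 + b t.2.1 + c t.2.2) = m * ∑ t ∈ Ψ, (a t.1 + b t.2.1 + c t.2.2) := by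
    simp only [Finset.sum_add_distrib, mul_add]
    rw [sum_leg_eq_mul H Ψ (fun t => t.1) a m j₁ h₁, sum_leg_eq_mul H Ψ (fun t => t.2.1) b m j₂ h₂,
      sum_leg_eq_mul H Ψ (fun t => t.2.2) c m j₃ h₃]
  rw [Finset.sum_eq_zero hzero, mul_zero, ← Finset.sum_filter_add_sum_filter_not H (· ∈ Ψ),
    Finset.sum_eq_zero (fun t ht => hzero t (Finset.mem_filter.mp ht).2), zero_add] at hH
  have hout : (#{t ∈ H | t ∉ Ψ} : R) * 1 ≤ ∑ t ∈ H with t ∉ Ψ, (a t.1 + b t.2.1 + c t.2.2) := by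
    rw [← nsmul_eq_mul]
    exact Finset.card_nsmul_le_sum _ _ _ fun t ht =>
      hone t (hHΦ (Finset.mem_filter.mp ht).1) (Finset.mem_filter.mp ht).2
  have hcnt : #{t ∈ H | t ∈ Ψ} + #{t ∈ H | t ∉ Ψ} = #H := Finset.card_filter_add_card_filter_not _
  have hle : #{t ∈ H | t ∈ Ψ} ≤ #Ψ := Finset.card_le_card fun t ht => (Finset.mem_filter.mp ht).2
  have hposR : (0 : R) < (#{t ∈ H | t ∉ Ψ} : R) * 1 := by
    rw [mul_one]; exact_mod_cast (show 0 < #{t ∈ H | t ∉ Ψ} by omega)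
  exact absurd (lt_of_lt_of_le hposR (hH ▸ hout)) (lt_irrefl 0)

/-- THE COUNTING STEP: for a size-8 diagonal with missing points `x, y, z` on the three legs,
`Σ_{t ∈ Ψ} cnt(α, t) + [x=α] + [y=α] + [z=α] = 9` in each coordinate. [new] -/
theorem count_identity {Ψ : Finset Tr} (hdiag : isDiagonal Ψ = true) {x y z : Pt}
    (i₁ : Ψ.image (fun t : Tr => t.1) = univ.erase x)
    (i₂ : Ψ.image (fun t : Tr => t.2.1) = univ.erase y)
    (i₃ : Ψ.image (fun t : Tr => t.2.2) = univ.erase z) (α : Fin 3) :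
    (∑ t ∈ Ψ, cnt₁ α t) + ((if x.1 = α then 1 else 0) + (if y.1 = α then 1 else 0) +
        (if z.1 = α then 1 else 0)) = 9 ∧
    (∑ t ∈ Ψ, cnt₂ α t) + ((if x.2 = α then 1 else 0) + (if y.2 = α then 1 else 0) +
        (if z.2 = α then 1 else 0)) = 9 := by
  obtain ⟨j₁, j₂, j₃⟩ := injOn_of_isDiagonal hdiag
  have ⟨ex, ey, ez⟩ : _ ∧ _ ∧ _ := ⟨card_erase_fibre x α, card_erase_fibre y α, card_erase_fibre z α⟩
  constructor <;> simp only [cnt₁, cnt₂, Finset.sum_add_distrib]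
  · rw [sum_ite_eq_card_image j₁ (fun p => p.1 = α), sum_ite_eq_card_image j₂ (fun p => p.1 = α),
      sum_ite_eq_card_image j₃ (fun p => p.1 = α), i₁, i₂, i₃]; omega
  · rw [sum_ite_eq_card_image j₁ (fun p => p.2 = α), sum_ite_eq_card_image j₂ (fun p => p.2 = α),
      sum_ite_eq_card_image j₃ (fun p => p.2 = α), i₁, i₂, i₃]; omega

/-- Shared skeleton of both frames: from the frame facts (size, 4-regularity, certificate fibres)
and the value counts over `Ψ` that pin the star, no diagonal of size `≥ 8` is a combinatorial
degeneration. [new] -/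
theorem no_diagonal_eight_of_facts [LinearOrder R] [IsStrictOrderedRing R] {Φ Ψ : Finset Tr}
    {a b c : Pt → R} (hzero : ∀ t ∈ Ψ, a t.1 + b t.2.1 + c t.2.2 = 0)
    (hone : ∀ t ∈ Φ, t ∉ Ψ → 1 ≤ a t.1 + b t.2.1 + c t.2.2)
    (hdiag : isDiagonal Ψ = true) (h8 : 8 ≤ #Ψ) (hΦ : 36 = #Φ)
    (reg : ∀ p, #{t ∈ Φ | t.1 = p} = 4 ∧ #{t ∈ Φ | t.2.1 = p} = 4 ∧ #{t ∈ Φ | t.2.2 = p} = 4)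
    (cnt0 : ∀ t ∈ Ψ, cnt₁ 0 t = 1 ∧ cnt₂ 0 t = 1)
    (par : #Ψ = 8 → ∀ α : Fin 3, α ≠ 0 → Even (∑ t ∈ Ψ, cnt₁ α t) ∧ Even (∑ t ∈ Ψ, cnt₂ α t))
    (cc : ∀ s ∈ tightFrame, #(cert Φ s) = 16)
    (cf : ∀ s ∈ tightFrame, ∀ p : Pt, #{t ∈ cert Φ s | t.1 = p} = (if p = s.1 then 0 else 2) ∧
      #{t ∈ cert Φ s | t.2.1 = p} = (if p = s.2.1 then 0 else 2) ∧
      #{t ∈ cert Φ s | t.2.2 = p} = (if p = s.2.2 then 0 else 2)) : False := by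
  have h9 := card_le_nine hdiag
  obtain ⟨j₁, j₂, j₃⟩ := injOn_of_isDiagonal hdiag
  rcases Nat.lt_or_ge (#Ψ) 9 with hlt | hge
  · -- size 8: locate the missing points, pin the star, apply the certificate
    have hΨ : #Ψ = 8 := by omega
    obtain ⟨x, hx⟩ := exists_eq_erase (I := Ψ.image fun t : Tr => t.1)
      (by rw [Finset.card_image_of_injOn j₁, hΨ])
    obtain ⟨y, hy⟩ := exists_eq_erase (I := Ψ.image fun t : Tr => t.2.1)
      (by rw [Finset.card_image_of_injOn j₂, hΨ])
    obtain ⟨z, hz⟩ := exists_eq_erase (I := Ψ.image fun t : Tr => t.2.2)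
      (by rw [Finset.card_image_of_injOn j₃, hΨ])
    have hsum0 : ∑ t ∈ Ψ, cnt₁ 0 t = 8 ∧ ∑ t ∈ Ψ, cnt₂ 0 t = 8 := by
      rw [Finset.sum_congr rfl fun t ht => (cnt0 t ht).1, Finset.sum_congr rfl fun t ht => (cnt0 t ht).2]
      simp [hΨ]
    have key := fun α => count_identity hdiag hx hy hz α
    have odd_of : ∀ {m n : ℕ}, Even n → n + m = 9 → Odd m := by
      rintro m n ⟨r, hr⟩ h; exact ⟨(m - 1) / 2, by omega⟩
    have hs : (x, y, z) ∈ tightFrame := by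
      simp only [tightFrame, Finset.mem_filter, Finset.mem_univ, true_and]
      refine ⟨dslot_of_counts x.1 y.1 z.1 ?_ (odd_of (par hΨ 1 (by decide)).1 (key 1).1)
        (odd_of (par hΨ 2 (by decide)).1 (key 2).1), dslot_of_counts x.2 y.2 z.2 ?_
        (odd_of (par hΨ 1 (by decide)).2 (key 1).2) (odd_of (par hΨ 2 (by decide)).2 (key 2).2)⟩
      · have := (key 0).1; have := hsum0.1; omega
      · have := (key 0).2; have := hsum0.2; omega
    have tr : ∀ (q p : Pt), (if p = q then 0 else 2) = (if p ∈ univ.erase q then 2 else 0) := by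
      intro q p; by_cases h : p = q <;> simp [h]
    refine farkas (H := cert Φ (x, y, z)) 2 hzero hone hdiag (Finset.filter_subset _ Φ)
      (by rw [cc _ hs]; omega) (fun p => ?_) (fun p => ?_) (fun p => ?_)
    · rw [(cf _ hs p).1, hx]; exact tr x p
    · rw [(cf _ hs p).2.1, hy]; exact tr y p
    · rw [(cf _ hs p).2.2, hz]; exact tr z p
  · -- size 9: the whole frame is the certificate
    have hΨ : #Ψ = 9 := le_antisymm h9 hge
    have full : ∀ g : Tr → Pt, Set.InjOn g Ψ → Ψ.image g = univ := fun g hg =>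
      Finset.eq_univ_of_card _ (by
        rw [Finset.card_image_of_injOn hg, hΨ]; simp [Fintype.card_prod, Fintype.card_fin])
    refine farkas 4 hzero hone hdiag (subset_refl Φ) (by omega) (fun p => ?_) (fun p => ?_)
      (fun p => ?_)
    · rw [(reg p).1, full _ j₁, if_pos (Finset.mem_univ _)]
    · rw [(reg p).2.1, full _ j₂, if_pos (Finset.mem_univ _)]
    · rw [(reg p).2.2, full _ j₃, if_pos (Finset.mem_univ _)]

end Generic

/-! ## §4 The theorems -/

section Main

variable {R : Type*} [CommRing R] [LinearOrder R] [IsStrictOrderedRing R]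

/-- **Toric ceiling, tight frame.**  In the tight frame `D ⊠ D` of `cw₂^{⊠2}` no diagonal with at
least `8` triples is a combinatorial degeneration (weights in any linearly ordered ring). [new] -/
theorem tightFrame_no_diagonal_comb_degeneration_eight {Ψ : Finset Tr} {a b c : Pt → R}
    (hsub : Ψ ⊆ tightFrame) (hzero : ∀ t ∈ Ψ, a t.1 + b t.2.1 + c t.2.2 = 0)
    (hone : ∀ t ∈ tightFrame, t ∉ Ψ → 1 ≤ a t.1 + b t.2.1 + c t.2.2)
    (hdiag : isDiagonal Ψ = true) (h8 : 8 ≤ #Ψ) : False := by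
  refine no_diagonal_eight_of_facts hzero hone hdiag h8 frames_regular.1.2
    (fun p => (frames_regular.2 p).2) (fun t ht => cnt_tight t (hsub ht) 0) (fun hΨ α _ => ?_)
    (fun s hs => (cert_fibres s hs).1.2) (fun s hs p => ((cert_fibres s hs).2 p).2)
  rw [Finset.sum_congr rfl fun t ht => (cnt_tight t (hsub ht) α).1,
    Finset.sum_congr rfl fun t ht => (cnt_tight t (hsub ht) α).2, Finset.sum_const, smul_eq_mul,
    mul_one, hΨ]
  decide

/-- **Toric ceiling, Coppersmith–Winograd frame.**  In the cw frame of `cw₂^{⊠2}` (the support of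
`kroneckerPow (cwTensor K 2) 2`, see `kroneckerPow_cwTensor_two_apply`) no diagonal with at least
`8` triples is a combinatorial degeneration (weights in any linearly ordered ring). [new] -/
theorem cwFrame_no_diagonal_comb_degeneration_eight {Ψ : Finset Tr} {a b c : Pt → R}
    (hsub : Ψ ⊆ cwFrame) (hzero : ∀ t ∈ Ψ, a t.1 + b t.2.1 + c t.2.2 = 0)
    (hone : ∀ t ∈ cwFrame, t ∉ Ψ → 1 ≤ a t.1 + b t.2.1 + c t.2.2)
    (hdiag : isDiagonal Ψ = true) (h8 : 8 ≤ #Ψ) : False :=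
  no_diagonal_eight_of_facts hzero hone hdiag h8 frames_regular.1.1
    (fun p => (frames_regular.2 p).1) (fun t ht => (cnt_cw t (hsub ht)).1)
    (fun _ α hα => ⟨Finset.even_sum _ fun t ht => ((cnt_cw t (hsub ht)).2 α hα).1,
      Finset.even_sum _ fun t ht => ((cnt_cw t (hsub ht)).2 α hα).2⟩)
    (fun s hs => (cert_fibres s hs).1.1) (fun s hs p => ((cert_fibres s hs).2 p).1)

end Main

/-! ## §5 Sharpness in the cw frame, and the bridges to the tree's tensors -/

/-- A size-7 diagonal of the cw frame (by exact LP: `672` of the `1968` size-7 diagonals of the cw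
frame are combinatorial degenerations; in the tight frame none of `2952` is). [new] -/
def psiSeven : Finset Tr :=
  {((0,1), (1,0), (1,1)), ((0,2), (1,2), (1,0)), ((1,0), (0,2), (1,2)), ((1,1), (1,1), (0,0)),
    ((2,0), (0,1), (2,1)), ((2,1), (2,0), (0,1)), ((2,2), (0,0), (2,2))}

/-- Leg-1 weights of the size-7 certificate (entries in `[-3, 5]`). [new] -/
def aSeven : Pt → ℤ := fun p => !![5, 0, 2; 1, 1, 5; -1, 0, -2] p.1 p.2

/-- Leg-2 weights of the size-7 certificate. [new] -/
def bSeven : Pt → ℤ := fun p => !![0, 0, 0; 0, 0, -3; 0, 2, 4] p.1 p.2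
/-- Leg-3 weights of the size-7 certificate. [new] -/
def cSeven : Pt → ℤ := fun p => !![-1, 0, 3; 1, 0, -1; 3, 1, 2] p.1 p.2

/-- **The cw-frame ceiling `7` is attained**: `psiSeven` with the weights above is a size-7 diagonal
combinatorial degeneration of the cw frame — a toric certificate of `⟨7⟩ ⊴ cw₂^{⊠2}` via
`OutsiderSandwichBorderSubrankTwenty.isApproxRestriction_of_monomial` (cf.
`OutsiderSandwichBorderSubrankSeven`). [new] -/
theorem cwFrame_diagonal_comb_degeneration_seven :
    psiSeven ⊆ cwFrame ∧ (∀ t ∈ psiSeven, aSeven t.1 + bSeven t.2.1 + cSeven t.2.2 = 0) ∧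
      (∀ t ∈ cwFrame, t ∉ psiSeven → 1 ≤ aSeven t.1 + bSeven t.2.1 + cSeven t.2.2) ∧
      isDiagonal psiSeven = true ∧ #psiSeven = 7 := by
  refine ⟨by decide +kernel, by decide +kernel, by decide +kernel, by decide +kernel, by decide +kernel⟩

/-- **The toric value of the cw frame is exactly `7`**: a size-7 diagonal combinatorial
degeneration exists and none of size `≥ 8` does (integer weights, as in BCS (15.29)). [new] -/
theorem cwFrame_toric_value :
    (∃ Ψ : Finset Tr, ∃ a b c : Pt → ℤ, Ψ ⊆ cwFrame ∧ (∀ t ∈ Ψ, a t.1 + b t.2.1 + c t.2.2 = 0) ∧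
      (∀ t ∈ cwFrame, t ∉ Ψ → 1 ≤ a t.1 + b t.2.1 + c t.2.2) ∧ isDiagonal Ψ = true ∧ #Ψ = 7) ∧
    ¬ (∃ Ψ : Finset Tr, ∃ a b c : Pt → ℤ, Ψ ⊆ cwFrame ∧ (∀ t ∈ Ψ, a t.1 + b t.2.1 + c t.2.2 = 0) ∧
      (∀ t ∈ cwFrame, t ∉ Ψ → 1 ≤ a t.1 + b t.2.1 + c t.2.2) ∧ isDiagonal Ψ = true ∧ 8 ≤ #Ψ) :=
  ⟨⟨psiSeven, aSeven, bSeven, cSeven, cwFrame_diagonal_comb_degeneration_seven⟩,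
    fun ⟨_, _, _, _, hsub, hzero, hone, hdiag, h8⟩ =>
      cwFrame_no_diagonal_comb_degeneration_eight hsub hzero hone hdiag h8⟩

/-- BRIDGE (cw frame = support of the literal host of `LaserTangency` at `N = 2`): the entry of
`kroneckerPow (cwTensor K 2) 2` at `(a, b, c)` is `1` if `((a 0, a 1), (b 0, b 1), (c 0, c 1))`
lies in `cwFrame` and `0` otherwise. [new] -/
theorem kroneckerPow_cwTensor_two_apply (K : Type) [Field K] (a b c : Fin 2 → Fin 3) :
    kroneckerPow (cwTensor K 2) 2 a b c =
      if ((a 0, a 1), (b 0, b 1), (c 0, c 1)) ∈ cwFrame then 1 else 0 := by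
  rw [kroneckerPow_apply, Fin.prod_univ_two, cwTensor_apply, cwTensor_apply]
  simp only [cwFrame, cwSlot, Finset.mem_filter, Finset.mem_univ, true_and, decide_eq_true_eq]
  by_cases h₁ : (a 0 = 0 ∧ b 0 = c 0 ∧ b 0 ≠ 0) ∨ (b 0 = 0 ∧ a 0 = c 0 ∧ a 0 ≠ 0) ∨
      (c 0 = 0 ∧ a 0 = b 0 ∧ a 0 ≠ 0) <;>
    by_cases h₂ : (a 1 = 0 ∧ b 1 = c 1 ∧ b 1 ≠ 0) ∨ (b 1 = 0 ∧ a 1 = c 1 ∧ a 1 ≠ 0) ∨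
      (c 1 = 0 ∧ a 1 = b 1 ∧ a 1 ≠ 0) <;>
    simp only [h₁, h₂, if_true, if_false, mul_one, mul_zero, and_self, and_true, and_false]

/-- BRIDGE (tight frame = support of `D ⊠ D` for the diagonalised tensor `D a b c = [a, b, c
pairwise distinct]`, `D ≅ cw₂` over `ℂ` by `OutsiderSandwichPencilSlack.restrictsTo_cwTwo` and
`OutsiderSandwichSubrankSix.diagPow_two_restrictsTo_cwPow_two`). [new] -/
theorem kronecker_diag_apply (K : Type) [Field K] {D : Fin 3 → Fin 3 → Fin 3 → K}
    (hD : ∀ a b c, D a b c = if a ≠ b ∧ b ≠ c ∧ a ≠ c then 1 else 0) (u v w : Pt) :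
    kroneckerTensor D D u v w = if (u, v, w) ∈ tightFrame then 1 else 0 := by
  rw [kroneckerTensor_apply, hD, hD]
  simp only [tightFrame, dSlot, Finset.mem_filter, Finset.mem_univ, true_and, decide_eq_true_eq]
  by_cases h₁ : u.1 ≠ v.1 ∧ v.1 ≠ w.1 ∧ u.1 ≠ w.1 <;> by_cases h₂ : u.2 ≠ v.2 ∧ v.2 ≠ w.2 ∧ u.2 ≠ w.2 <;>
    simp [h₁, h₂]

end Summit.MatrixMultiplication.MatrixMultiplication.Theorems.OutsiderSandwichToricCeiling
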